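import Literature.MathematicalPhysics.QuantumFieldTheory.Balaban1983to89.B8LeafKnitRS
import Literature.MathematicalPhysics.QuantumFieldTheory.Balaban1983to89.B8Thm2ZdGF3PMapGammaPrime

/-!
# `Balaban1983to89.B8LeafKnitZdGF3PGammaPrime` — [Balaban1985RegularSpaces] THE RE-TYPED B8 LEAF `B8LeafKnitRS.B8LeafRS` (Lemma 1 p. 79 – Theorem 8 p. 101)
# ON ANY INDEX-MAPPED `Ω₀ = ℤᵈ` SUB-FAMILY OF THE P-CARRIER `B8LeafModelZd3P.zdGF3HP` OVER THE γ′ (ONE-END-POINT, SOURCED) SOCKET FAMILY OF RECORD —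
# dag-n05-w3's `B8LeafKnitZd3PGamma.b8LeafRS_zd3HP_map_γ` with `t2 := thm2Printed_zdGF3HP_mapJ_γ'`, `t4 := thm4Printed_zdGF3HP_mapJ_γ'` (this seat's γ′ faces
# on dag-n05-d's core), Theorem 4's constant print's `5dL·B₈`; `p3 :=` Proposition 3 on the carrier as ONE hypothesis; `p5e p5u p6 p7 t8` named hypotheses

statement-level skeleton of published theorems with citation tags; proofs where landed; nothing here is a claim about the Yang–Mills mass gap

T. Bałaban, *Spaces of regular gauge field configurations on a lattice and gauge fixing conditions*, Commun. Math. Phys. **99** (1985) 75–102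
`[Balaban1985RegularSpaces]` ("B8"; journal page = PDF page + 74): Lemma 1 p. 79, Thm 2 p. 83, Prop. 3 p. 87, Thm 4 p. 88, Props. 5–7 pp. 94–100, Thm 8 p. 101.

## WHY THIS FILE (cell `pub-ymgap`, HUMAN RULING D-0149 width push; seat `pub-ymgap-dag-n05-w2`, WIDTH SEAT 2 of 4 on NODE n05 = [B8]; count-neutral)

The (D6″) item of the §n05 γ chain.  dag-n05-w3's D6 knits (`B8LeafKnitZd3PGamma`, p591003 + v1.1) read Theorems 2 ∕ 4 off this seat's γ EDITION
(`B8Thm4Zd3Gamma` ∕ `B8LeafModelZd3PThm2Gamma`: sockets with the box-form (1.35) antecedent, Theorem 4's constant inflated by the bridge `K = 26384(d+1)L`),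
while the record's Theorem 8 face (dag-n05-d's `B8Thm8SurvivingZdGF3HPMapLanEGamma`) reads the γ′ SOURCED socket family of `B8Thm4CoreZdGF3HPLanEGamma`
(one-end-point antecedent = the P-carrier's own letter; the family dag-n05-w4's γ′ providers inhabit).  THIS FILE is the leaf knit whose `t2` ∕ `t4` sit
on THAT family too — `t2 := B8Thm2ZdGF3PMapGammaPrime.thm2Printed_zdGF3HP_mapJ_γ'`, `t4 := B8Thm4ZdGF3PMapGammaPrime.thm4Printed_zdGF3HP_mapJ_γ'` (sockets ∕ zero source INDEX-GENERIC along `ι`, dag-n05-d's A6 point (3)) (zero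
source `φ₀`; tower laws at `ι a`), `l1` by kernel instance, `p3 := hP3` ON THE IMAGE family `zdGF3P ∘ ι` (dag-n05-d's `prop3Printed_zdGF3P_map_γ`; not over all `ZdIdx`, A6) — so a P-slot knit can discharge ALL its [B8] sockets from ONE provider
family.  ★★ `b8LeafRS_zdGF3HP_mapJ_γ'` (index map `ι : J → ZdIdx d L` into `Ω₀ = ℤᵈ` members; NODE 00's record family is `ι := (·.1.1)` on `IdxB8SubB θ`,
tower laws `IdxB8Sub.tower_all`).

## HONEST SCOPE

A knit BY NAME; NO estimate; every socket (the four sourced member sockets of Thm 4's frame, the zero-source triple, the tower laws), `hP3` (Prop. 3 on the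
carrier, dag-n05-d's `prop3Printed_zdGF3P_γ`) and the five remaining printed statements `p5e p5u p6 p7 t8` are HYPOTHESES (A6: socket providers =
dag-n05-w4's γ′ chain modulo [4]'s letters; m = 0 inhabited by the tree's `Ω₀ = ℤᵈ` suppliers, m ≥ 1 = N06 content, OPEN; no joint-satisfiability claim).
Not a discharge of N05; count-neutral; no count claim; one finite `T⁴` programme at fixed `ε`, Bałaban AS PRINTED; the Yang–Mills mass gap (Clay) is NOT
proved by any of this — R4 closes the conditional finite-𝕋⁴ rung `BalabanLadder.UV` only; nothing continuum ∕ ℝ⁴ ∕ OS.  No `sorry`, no `def`, no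
`instance`, no `notation`.  Unit `pub-ymgap-dag-n05-w2` (g0), 2026-08-28.

[cite: Balaban1985RegularSpaces, Lemma 1 p.79, Thm 2 p.83, Prop. 3 p.87, Thm 4 p.88 (kernel instances ∕ `hP3`); Prop. 5 p.94, Prop. 6 p.99, Prop. 7 p.100, Thm 8 p.101 (named hypotheses); p.77]
-/

noncomputable section

namespace Literature.MathematicalPhysics.QuantumFieldTheory.Balaban1983to89.B8LeafKnitZdGF3PGammaPrime

open B7Prop1Explicit B7Prop2Explicit B7Prop1Local B7Eq92Concrete
open B7Prop2Explicit (unitaryUnits)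
open B7Prop4GeneralLevels (linCovIter)
open B8Ineq132 (covDerivFwd InAk)
open B8Eq119TwistedAxial (Restr129 InAx)
open B8Eq184Proof (gaugeExp cfgExp)
open B8Lemma1NonAbelian (mulCfg blockPairNA lemma1Printed_blockPairNA)
open B8Eq140Level (SideTouches)
open B8Eq146AExpansion (iEta)
open B8Eq155JBound (Jcur wsup)
open B8ScaledSupNorm (bondNorm msup)
open B8Ineq130 (tlo thi)
open B8Eq138LandauZd (IsLandau138W)
open B8LeafKnitRS (B8LeafRS)
open B8LeafModelZd (ZdIdx)
open B8LeafModelZd3P (zdGF3P zdGF3HP)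
open B8TowerBondsPrinted (towerBondsP)
open B8Thm4ZdGF3PMapGammaPrime (thm4Printed_zdGF3HP_mapJ_γ')
open B8Thm2ZdGF3PMapGammaPrime (thm2Printed_zdGF3HP_mapJ_γ')

-- `Site` alone could resolve to the torus sites of `Setup.lean`; re-export the `ℤ^d` sites of `B7Prop1Explicit`.
export B7Prop1Explicit (Site)

variable {d : ℕ}

section Knit

variable {𝔸 : Type} [CStarAlgebra 𝔸] [Nontrivial 𝔸]
variable {I₃ I₄ : Type} {lan : I₃ → B8.LandauData} {cub : I₄ → B8.CubeData}

/-- ★★ **THE RE-TYPED B8 LEAF ON AN INDEX-MAPPED `Ω₀ = ℤᵈ` SUB-FAMILY OF THE P-CARRIER `zdGF3HP`, γ′ SOCKET FAMILY, ZERO SOURCE — FOUR CONJUNCTS BY KERNEL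
INSTANCES.**  For `d, L ≥ 2`, the leaf's `inp : B9Inputs`, `B₀β > 0`, Prop. 5's radius `cu > 0` and the providers' threshold `cP > 0`, source constants
`γ′ ≥ 0`, `B₈ ≥ inp.B₀` with `5dL·inp.B₀ + 2γ′·inp.B₀ ≤ 5dL·B₈`, `2 ≤ 5dL·B₈`, a (1.61)-constant `C₂ ≤ 2097152(d+1)²L²`, any Hölder data `β, len`, any block
size `Lb`; the γ′ socket family of record ALONG `ι` (dag-n05-d's `thm4Core_zdGF3HP_map_lanE_γ'` binders: source data `Φ, Adm a, LanF a`, the four sourced sockets AT `ι a`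
with the carrier's one-end-point (1.35) antecedent, at `B₀ := inp.B₀`, `B₀′ := inp.B₀′`), a zero source `(φ₀, hAdm₀, hLan₀)`; PROPOSITION 3 on the image family `zdGF3P ∘ ι` as one
hypothesis `hP3`; an index map `ι : J → ZdIdx d L` into `Ω₀ = ℤᵈ` members with their tower laws at every truncation; and the five remaining printed statements
as hypotheses: `B8LeafRS d L C₂ (5dL·B₈) inp.B₀′ B₁ B₂ c₁ inp B₀β (blockPairNA d Lb 𝔸) (zdGF3HP ∘ ι) lan cub toAxial` with `l1 := lemma1Printed_blockPairNA`,
`t2 := thm2Printed_zdGF3HP_mapJ_γ'`, `p3 := hP3` (Prop. 3 on the IMAGE family), `t4 := thm4Printed_zdGF3HP_mapJ_γ'`.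
[cite: Balaban1985RegularSpaces, Lemma 1 p.79, Thm 2 p.83, Prop. 3 p.87, Thm 4 p.88 (kernel instances ∕ `hP3`); Prop. 5 p.94, Prop. 6 p.99, Prop. 7 p.100, Thm 8 p.101 (named hypotheses); p.77] -/
theorem b8LeafRS_zdGF3HP_mapJ_γ' (hd2 : 2 ≤ d) {L : ℕ} (hL : 2 ≤ L) (Lb : ℕ) (β : ℝ) (len : Site d → ℝ) (inp : B8.B9Inputs)
    {B₀β C₂ cu cP B₁ B₂ c₁ : ℝ} (hB₀β : 0 < B₀β) (hC₂ : C₂ ≤ 2097152 * ((d : ℝ) + 1) ^ 2 * (L : ℝ) ^ 2) (hcu : 0 < cu) (hcP : 0 < cP)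
    {Φ : Type*} {γ' B₈ : ℝ} (hγ' : 0 ≤ γ') (hB₈ : 0 < B₈) (hB₀8 : inp.B₀ ≤ B₈) (hB : 2 ≤ 5 * (d : ℝ) * L * B₈)
    (hγB : 5 * (d : ℝ) * L * inp.B₀ + 2 * (γ' * inp.B₀) ≤ 5 * (d : ℝ) * L * B₈)
    {J : Type} (ι : J → ZdIdx d L)
    (Adm : J → Φ → (Site d → Fin d → 𝔸ˣ) → ℝ → ℝ → Prop)
    (LanF : J → (Site d → Fin d → 𝔸ˣ) → Φ → ℕ → (Site d → Fin d → 𝔸ˣ) → Prop)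
    (SP5base : ∀ a : J, ∀ α₀ α₁ : ℝ, 0 < α₀ → 0 < α₁ → α₀ + α₁ ≤ cP →
      ∀ U₀ U' : Site d → Fin d → 𝔸ˣ, (∀ x κ, U₀ x κ ∈ unitaryUnits 𝔸) → (∀ x κ, U' x κ ∈ unitaryUnits 𝔸) →
      ∀ φ : Φ, Adm a φ U₀ α₀ α₁ →
      InAk L (ι a).k (ι a).η α₀ (ι a).Ω U₀ → InAk L (ι a).k (ι a).η α₀ (ι a).Ω (mulCfg U' U₀) → (∀ m, m ≤ (ι a).k → InAx L m ((ι a).Λs m) U₀ (mulCfg U' U₀)) →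
      (∀ j, j ≤ (ι a).k → ∀ (z : Site d) (μ : Fin d),
        ((∀ x, InBox (tlo L z j) (thi L z j) x → x ∈ (ι a).Ω j) ∨ (∀ x, InBox (tlo L (z + e μ) j) (thi L (z + e μ) j) x → x ∈ (ι a).Ω j)) →
        ‖(avgIter L (mulCfg U' U₀) j z μ : 𝔸) - (avgIter L U₀ j z μ : 𝔸)‖ ≤ α₁) →
      (∀ b ∈ {b : Site d × Fin d | SideTouches ((ι a).Ω 0) b.1 b.2}, ‖((U' b.1 b.2 : 𝔸ˣ) : 𝔸) - 1‖ ≤ α₁) →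
      (∃ (v : Site d → 𝔸ˣ) (lam : Site d → 𝔸), (∀ x, v x ∈ unitaryUnits 𝔸) ∧ (∀ x, x ∉ (ι a).Ω 0 → v x = 1) ∧
        (∀ j, j ≤ 1 → ∀ b ∈ {b : Site d × Fin d | SideTouches ((ι a).Ω j) b.1 b.2}, (v b.1 : 𝔸) = ((gaugeExp lam b.1 : 𝔸ˣ) : 𝔸) ∧
        (v (b.1 + e b.2) : 𝔸) = ((gaugeExp lam (b.1 + e b.2) : 𝔸ˣ) : 𝔸)) ∧
        (∀ j, j ≤ 1 → ∀ b ∈ {b : Site d × Fin d | SideTouches ((ι a).Ω j) b.1 b.2},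
        ‖lam b.1‖ ≤ (8 * inp.B₀' * (5 * (d : ℝ) * L * B₈) * (α₀ + α₁)) ∧ ((L : ℝ) ^ j * (ι a).η) * ‖covDerivFwd (ι a).η U₀ b.2 lam b.1‖ ≤ (8 * inp.B₀' * (5 * (d : ℝ) * L * B₈) * (α₀ + α₁))) ∧
        LanF a U₀ φ 1 (mgauge U₀ v⁻¹ U') ∧ Restr129 L 1 ((ι a).Λs 1) U₀ ((1 : Site d → 𝔸ˣ) * v)))
    (SP5 : ∀ a : J, ∀ α₀ α₁ : ℝ, 0 < α₀ → 0 < α₁ → α₀ + α₁ ≤ cP →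
      ∀ U₀ U' : Site d → Fin d → 𝔸ˣ, (∀ x κ, U₀ x κ ∈ unitaryUnits 𝔸) → (∀ x κ, U' x κ ∈ unitaryUnits 𝔸) →
      ∀ φ : Φ, Adm a φ U₀ α₀ α₁ →
      InAk L (ι a).k (ι a).η α₀ (ι a).Ω U₀ → InAk L (ι a).k (ι a).η α₀ (ι a).Ω (mulCfg U' U₀) → (∀ m, m ≤ (ι a).k → InAx L m ((ι a).Λs m) U₀ (mulCfg U' U₀)) →
      (∀ j, j ≤ (ι a).k → ∀ (z : Site d) (μ : Fin d),
        ((∀ x, InBox (tlo L z j) (thi L z j) x → x ∈ (ι a).Ω j) ∨ (∀ x, InBox (tlo L (z + e μ) j) (thi L (z + e μ) j) x → x ∈ (ι a).Ω j)) →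
        ‖(avgIter L (mulCfg U' U₀) j z μ : 𝔸) - (avgIter L U₀ j z μ : 𝔸)‖ ≤ α₁) →
      (∀ b ∈ {b : Site d × Fin d | SideTouches ((ι a).Ω 0) b.1 b.2}, ‖((U' b.1 b.2 : 𝔸ˣ) : 𝔸) - 1‖ ≤ α₁) →
      (∀ m, 1 ≤ m → m < (ι a).k → ∀ (u₁ : Site d → 𝔸ˣ) (U₁ : Site d → Fin d → 𝔸ˣ) (A : Site d → Fin d → 𝔸),
        (∀ x, u₁ x ∈ unitaryUnits 𝔸) → (∀ x, x ∉ (ι a).Ω 0 → u₁ x = 1) → mgauge U₀ u₁ U₁ = U' → Restr129 L m ((ι a).Λs m) U₀ u₁ →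
        LanF a U₀ φ m U₁ →
        (∀ j, j ≤ m → ∀ b ∈ {b : Site d × Fin d | SideTouches ((ι a).Ω j) b.1 b.2},
        U₁ b.1 b.2 = cfgExp (ι a).η A b.1 b.2 ∧ IsSelfAdjoint (A b.1 b.2) ∧ ‖A b.1 b.2‖ ≤ (5 * (d : ℝ) * L * B₈ * (α₀ + α₁)) * ((L : ℝ) ^ j * (ι a).η)⁻¹) →
        ∃ (v : Site d → 𝔸ˣ) (lam : Site d → 𝔸), (∀ x, v x ∈ unitaryUnits 𝔸) ∧ (∀ x, x ∉ (ι a).Ω 0 → v x = 1) ∧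
        (∀ j, j ≤ m + 1 → ∀ b ∈ {b : Site d × Fin d | SideTouches ((ι a).Ω j) b.1 b.2}, (v b.1 : 𝔸) = ((gaugeExp lam b.1 : 𝔸ˣ) : 𝔸) ∧
        (v (b.1 + e b.2) : 𝔸) = ((gaugeExp lam (b.1 + e b.2) : 𝔸ˣ) : 𝔸)) ∧
        (∀ j, j ≤ m + 1 → ∀ b ∈ {b : Site d × Fin d | SideTouches ((ι a).Ω j) b.1 b.2},
        ‖lam b.1‖ ≤ (8 * inp.B₀' * (5 * (d : ℝ) * L * B₈) * (α₀ + α₁)) ∧ ((L : ℝ) ^ j * (ι a).η) * ‖covDerivFwd (ι a).η U₀ b.2 lam b.1‖ ≤ (8 * inp.B₀' * (5 * (d : ℝ) * L * B₈) * (α₀ + α₁))) ∧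
        LanF a U₀ φ (m + 1) (mgauge U₀ v⁻¹ U₁) ∧ Restr129 L (m + 1) ((ι a).Λs (m + 1)) U₀ (u₁ * v)))
    (SH59src : ∀ a : J, ∀ α₀ α₁ : ℝ, 0 < α₀ → 0 < α₁ → α₀ + α₁ ≤ cP →
      ∀ U₀ U' : Site d → Fin d → 𝔸ˣ, (∀ x κ, U₀ x κ ∈ unitaryUnits 𝔸) → (∀ x κ, U' x κ ∈ unitaryUnits 𝔸) →
      ∀ φ : Φ, Adm a φ U₀ α₀ α₁ →
      InAk L (ι a).k (ι a).η α₀ (ι a).Ω U₀ → InAk L (ι a).k (ι a).η α₀ (ι a).Ω (mulCfg U' U₀) → (∀ m, m ≤ (ι a).k → InAx L m ((ι a).Λs m) U₀ (mulCfg U' U₀)) →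
      (∀ j, j ≤ (ι a).k → ∀ (z : Site d) (μ : Fin d),
        ((∀ x, InBox (tlo L z j) (thi L z j) x → x ∈ (ι a).Ω j) ∨ (∀ x, InBox (tlo L (z + e μ) j) (thi L (z + e μ) j) x → x ∈ (ι a).Ω j)) →
        ‖(avgIter L (mulCfg U' U₀) j z μ : 𝔸) - (avgIter L U₀ j z μ : 𝔸)‖ ≤ α₁) →
      (∀ b ∈ {b : Site d × Fin d | SideTouches ((ι a).Ω 0) b.1 b.2}, ‖((U' b.1 b.2 : 𝔸ˣ) : 𝔸) - 1‖ ≤ α₁) →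
      (∀ m, 1 ≤ m → m ≤ (ι a).k → ∀ (u : Site d → 𝔸ˣ) (W : Site d → Fin d → 𝔸ˣ) (A' : Site d → Fin d → 𝔸),
        (∀ x, u x ∈ unitaryUnits 𝔸) → mgauge U₀ u W = U' → Restr129 L m ((ι a).Λs m) U₀ u → LanF a U₀ φ m W →
        (∀ y τ, IsSelfAdjoint (A' y τ)) →
        (∀ j, j ≤ m → ∀ y τ, SideTouches ((ι a).Ω j) y τ →
        W y τ = cfgExp (ι a).η A' y τ ∧ ‖A' y τ‖ ≤ (2 * (L * (5 * (d : ℝ) * L * B₈ * (α₀ + α₁))) + 8 * (8 * inp.B₀' * (5 * (d : ℝ) * L * B₈) * (α₀ + α₁))) * ((L : ℝ) ^ j * (ι a).η)⁻¹) →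
        (∀ y τ, (∀ j, j ≤ m → ¬ SideTouches ((ι a).Ω j) y τ) → A' y τ = 0) →
        msup L m (ι a).η (-(1 : ℝ)) (fun j (b : Site d × Fin d) => SideTouches ((ι a).Ω j) b.1 b.2) (fun b => A' b.1 b.2)
        ≤ inp.B₀ * (bondNorm L m (ι a).η (-(3 : ℝ)) (ι a).Ω (fun x μ => Jcur (ι a).η U₀ A' μ x)
        + wsup 1 (fun p : {p : ℕ × (Site d × Fin d) // p.1 ≤ m ∧ p.2 ∈ towerBondsP L (ι a).Ω ((ι a).Λs m) p.1} =>
        linCovIter L U₀ (iEta (ι a).η A') p.1.1 p.1.2.1 p.1.2.2)) + γ' * inp.B₀ * (α₀ + α₁) ∧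
        msup L m (ι a).η (-(2 : ℝ)) (fun j (t : Fin d × Fin d × Site d) => SideTouches ((ι a).Ω j) t.2.2 t.2.1)
        (fun t => covDerivFwd (ι a).η U₀ t.1 (fun z => A' z t.2.1) t.2.2)
        ≤ inp.B₀ * (bondNorm L m (ι a).η (-(3 : ℝ)) (ι a).Ω (fun x μ => Jcur (ι a).η U₀ A' μ x)
        + wsup 1 (fun p : {p : ℕ × (Site d × Fin d) // p.1 ≤ m ∧ p.2 ∈ towerBondsP L (ι a).Ω ((ι a).Λs m) p.1} =>
        linCovIter L U₀ (iEta (ι a).η A') p.1.1 p.1.2.1 p.1.2.2)) + γ' * inp.B₀ * (α₀ + α₁)))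
    (SP5u : ∀ a : J, ∀ α₀ α₁ : ℝ, 0 < α₀ → 0 < α₁ → α₀ + α₁ ≤ cP →
      ∀ U₀ U' : Site d → Fin d → 𝔸ˣ, (∀ x κ, U₀ x κ ∈ unitaryUnits 𝔸) → (∀ x κ, U' x κ ∈ unitaryUnits 𝔸) →
      ∀ φ : Φ, Adm a φ U₀ α₀ α₁ →
      InAk L (ι a).k (ι a).η α₀ (ι a).Ω U₀ → InAk L (ι a).k (ι a).η α₀ (ι a).Ω (mulCfg U' U₀) → (∀ m, m ≤ (ι a).k → InAx L m ((ι a).Λs m) U₀ (mulCfg U' U₀)) →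
      (∀ j, j ≤ (ι a).k → ∀ (z : Site d) (μ : Fin d),
        ((∀ x, InBox (tlo L z j) (thi L z j) x → x ∈ (ι a).Ω j) ∨ (∀ x, InBox (tlo L (z + e μ) j) (thi L (z + e μ) j) x → x ∈ (ι a).Ω j)) →
        ‖(avgIter L (mulCfg U' U₀) j z μ : 𝔸) - (avgIter L U₀ j z μ : 𝔸)‖ ≤ α₁) →
      (∀ b ∈ {b : Site d × Fin d | SideTouches ((ι a).Ω 0) b.1 b.2}, ‖((U' b.1 b.2 : 𝔸ˣ) : 𝔸) - 1‖ ≤ α₁) →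
      ∀ u₁ : Site d → 𝔸ˣ, (∀ x, u₁ x ∈ unitaryUnits 𝔸) → (∀ x, x ∉ (ι a).Ω 0 → u₁ x = 1) → Restr129 L (ι a).k ((ι a).Λs (ι a).k) U₀ u₁ →
      LanF a U₀ φ (ι a).k (mgauge U₀ u₁⁻¹ U') →
      (∃ A₁ : Site d → Fin d → 𝔸, ∀ j, j ≤ (ι a).k → ∀ (x : Site d) (κ : Fin d), SideTouches ((ι a).Ω j) x κ →
        mgauge U₀ u₁⁻¹ U' x κ = cfgExp (ι a).η A₁ x κ ∧ ‖A₁ x κ‖ ≤ (5 * (d : ℝ) * L * B₈ * (α₀ + α₁)) * ((L : ℝ) ^ j * (ι a).η)⁻¹) →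
      ∀ (v w : Site d → 𝔸ˣ) (lam mu : Site d → 𝔸),
      (∀ x, ((gaugeExp lam x : 𝔸ˣ) : 𝔸) = ((v x : 𝔸ˣ) : 𝔸) ∧ IsSelfAdjoint (lam x) ∧ ‖lam x‖ < cu) → (∀ x, x ∉ (ι a).Ω 0 → lam x = 0) →
      (∀ j, j ≤ (ι a).k → ∀ b ∈ {b : Site d × Fin d | SideTouches ((ι a).Ω j) b.1 b.2}, ((L : ℝ) ^ j * (ι a).η) * ‖covDerivFwd (ι a).η U₀ b.2 lam b.1‖ < cu) →
      (∀ x, ((gaugeExp mu x : 𝔸ˣ) : 𝔸) = ((w x : 𝔸ˣ) : 𝔸) ∧ IsSelfAdjoint (mu x) ∧ ‖mu x‖ < cu) → (∀ x, x ∉ (ι a).Ω 0 → mu x = 0) →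
      (∀ j, j ≤ (ι a).k → ∀ b ∈ {b : Site d × Fin d | SideTouches ((ι a).Ω j) b.1 b.2}, ((L : ℝ) ^ j * (ι a).η) * ‖covDerivFwd (ι a).η U₀ b.2 mu b.1‖ < cu) →
      LanF a U₀ φ (ι a).k (mgauge U₀ v⁻¹ (mgauge U₀ u₁⁻¹ U')) → Restr129 L (ι a).k ((ι a).Λs (ι a).k) U₀ (u₁ * v) →
      LanF a U₀ φ (ι a).k (mgauge U₀ w⁻¹ (mgauge U₀ u₁⁻¹ U')) → Restr129 L (ι a).k ((ι a).Λs (ι a).k) U₀ (u₁ * w) →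
      ∀ x, v x = w x)
    (φ₀ : Φ) (hAdm₀ : ∀ a : J, ∀ α₀ α₁ : ℝ, 0 < α₀ → 0 < α₁ → ∀ U₀ : Site d → Fin d → 𝔸ˣ, (∀ x κ, U₀ x κ ∈ unitaryUnits 𝔸) →
      Adm a φ₀ U₀ α₀ α₁)
    (hLan₀ : ∀ a : J, ∀ U₀ W : Site d → Fin d → 𝔸ˣ,
      LanF a U₀ φ₀ (ι a).k W ↔ IsLandau138W L (ι a).k (ι a).η ((ι a).Ω 0) ((ι a).Λs (ι a).k) U₀ W)
    (hΩ : ∀ a : J, (ι a).Ω 0 = Set.univ)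
    (htw : ∀ a : J, ∀ m, m ≤ (ι a).k → ∀ j, j ≤ m → ∀ y ∈ (ι a).Λs m j, ∀ x, InBox (tlo L y j) (thi L y j) x → x ∈ (ι a).Ω j)
    -- PROPOSITION 3 AS PRINTED on the IMAGE family (dag-n05-d's `prop3Printed_zdGF3P_map_γ (ι)`; A6: not over all `ZdIdx`)
    (hP3 : B8.Prop3Printed d (L : ℝ) C₂ inp B₀β (fun a : J => (zdGF3P 𝔸 L β len (ι a)).toGFData2))
    {toAxial : ∀ a : J, (zdGF3HP 𝔸 L β len (ι a)).Cfg → (zdGF3HP 𝔸 L β len (ι a)).Pert → (zdGF3HP 𝔸 L β len (ι a)).Pert}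
    (p5e : B8.Prop5Exists inp.B₀' B₁ lan) (p5u : B8.Prop5Unique lan) (p6 : B8.Prop6Printed d (L : ℝ) B₁ c₁ cub)
    (p7 : B8SectGH.Prop7PrintedR (fun a : J => zdGF3HP 𝔸 L β len (ι a)) toAxial)
    (t8 : B8Thm8Surviving.Thm8SurvivingAt 1 B₁ B₂ (fun a : J => zdGF3HP 𝔸 L β len (ι a))) :
    B8LeafRS d (L : ℝ) C₂ (5 * (d : ℝ) * L * B₈) inp.B₀' B₁ B₂ c₁ inp B₀β (blockPairNA d Lb 𝔸)
      (fun a : J => zdGF3HP 𝔸 L β len (ι a)) lan cub toAxial where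
  l1 := lemma1Printed_blockPairNA d Lb 𝔸
  t2 := thm2Printed_zdGF3HP_mapJ_γ' hd2 hL inp hB₀β hcu hcP hC₂ hγ' hB₈ hB₀8 hB hγB ι Adm LanF SP5base SP5 SH59src SP5u φ₀ hAdm₀ hLan₀
    hΩ htw hP3
  p3 := hP3
  t4 := thm4Printed_zdGF3HP_mapJ_γ' hd2 hL inp.B₀_pos inp.B₀'_pos hcu hcP hγ' hB₈ hB₀8 hB hγB ι Adm LanF SP5base SP5 SH59src SP5u
    φ₀ hAdm₀ hLan₀ htw
  p5e := p5e
  p5u := p5u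
  p6 := p6
  p7 := p7
  t8 := t8

end Knit

#print axioms b8LeafRS_zdGF3HP_mapJ_γ'

end Literature.MathematicalPhysics.QuantumFieldTheory.Balaban1983to89.B8LeafKnitZdGF3PGammaPrime

end
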